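import Literature.Combinatorics.Sahi2008.ProductOfChains
import HarnessLib

/-!
# Sahi's conjecture for FKG measures on a product of two chains, I: stochastic monotonicity and the monotone quantile coupling

Support file of the one-cut programme (crux `NoHeavyLowerTail`, stmt-CriticalPhenomena-4575; cell `prim-masterthm`, seat P3, gen 16;
`run/shared/lean/prim/prim-masterthm/prim-masterthm-p3/HIERARCHY.md` §24; memo
`run/shared/lean/prim/prim-masterthm/FROM-prim-masterthm-p3-g16-TWO-CHAIN-COEFFICIENTS.md` §6).

GOAL (completed in `…SahiTwoChainFKG`): **Sahi's Conjecture 5 [Sahi2008, Conj. 5; LiebSahi2021, Conj. 1.1] holds for EVERY FKG probability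
weight on a product of two finite chains, at every order** — Lieb–Sahi proved it for Lebesgue measure on `[0,1]²` [LiebSahi2021, Thm. 3.7] (tree:
`ProductChains.sahiPositive_prodWeight_linearOrder`, every PRODUCT weight); the general log-supermodular weight is reached by a monotone coupling.
THIS FILE (the coupling):
* `tail_mul_row_le`, `cdf_anti` — the FKG lattice condition on `α × β` makes the conditional law of the second coordinate stochastically
  nondecreasing in the first (`μ(x, >y)·μ(x') ≤ μ(x', >y)·μ(x)` for `x ≤ x'`: the lattice condition for the pairs `(x,y₁), (x',y₂)`, `y₂ ≤ y < y₁`).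
* `rowMass`, `cdf`, `cdfLt`, `quantile` — the conditional distribution functions and the level-`(k+1)/N` quantile of a row;
  `quantile_le_iff` / `quantile_lt_iff` (`quantile ≤ y ↔ (k+1)/N ≤ F(y|x)`), `quantile_mono_row` (monotone in the row, by `cdf_anti`),
  `quantile_mono_level`, and the level counts `card_quantile_le/lt` (`#{k < N : quantile_k ≤ y} = ⌊N·F(y|x)⌋`).
* `PosRow`, `latentWeight`, `latentMap`, `approxMeasure` — the latent product space (rows of positive mass) `× Fin N` with the weight
  (row mass) ⊗ (uniform), the coupling map `(x,k) ↦ (x, quantile_k(x))`, and the push-forward `μ_N` (→ `μ`, in the sequel).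
Everything PROVED, standard axioms. [this work]
-/

noncomputable section

open scoped Classical
open Filter Topology

namespace Summit.CriticalPhenomena.PercolationContinuityZ3.Theorems

open Finset Function
open Literature.Combinatorics.Sahi2008

namespace SahiTwoChain

section FKG

variable {α β : Type*} [LinearOrder β] [Fintype β]

/-- **Cross inequality for the tails of two rows of an FKG measure on a product of two chains**: for `x ≤ x'` and any `y`,
`μ(row x, above y) · μ(row x') ≤ μ(row x', above y) · μ(row x)` — the conditional law of the second coordinate is stochastically
nondecreasing in the first (the lattice condition applied to `(x, y₁), (x', y₂)` with `y₂ ≤ y < y₁`). [this work] -/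
theorem tail_mul_row_le [LinearOrder α] [Fintype α] {μ : α × β → ℝ} (hμ : IsFKGMeasure μ) {x x' : α} (hxx' : x ≤ x') (y : β) :
    (∑ y₁ ∈ univ.filter (fun y₁ => y < y₁), μ (x, y₁)) * (∑ y₂, μ (x', y₂)) ≤
      (∑ y₁ ∈ univ.filter (fun y₁ => y < y₁), μ (x', y₁)) * (∑ y₂, μ (x, y₂)) := by
  -- split each full row into "above y" and "not above y"
  rw [← Finset.sum_filter_add_sum_filter_not univ (fun y₂ => y < y₂) (fun y₂ => μ (x', y₂)),
    ← Finset.sum_filter_add_sum_filter_not univ (fun y₂ => y < y₂) (fun y₂ => μ (x, y₂)), mul_add, mul_add,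
    mul_comm (∑ y₁ ∈ univ.filter (fun y₁ => y < y₁), μ (x, y₁)) (∑ y₁ ∈ univ.filter (fun y₁ => y < y₁), μ (x', y₁)),
    add_le_add_iff_left, Finset.sum_mul_sum, Finset.sum_mul_sum]
  refine Finset.sum_le_sum fun y₁ hy₁ => Finset.sum_le_sum fun y₂ hy₂ => ?_
  rw [Finset.mem_filter] at hy₁ hy₂
  have h12 : y₂ ≤ y₁ := (not_lt.1 hy₂.2).trans hy₁.2.le
  have key := hμ.mul_le_mul (x, y₁) (x', y₂)
  have hinf : ((x, y₁) : α × β) ⊓ (x', y₂) = (x, y₂) := Prod.ext (min_eq_left hxx') (min_eq_right h12)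
  have hsup : ((x, y₁) : α × β) ⊔ (x', y₂) = (x', y₁) := Prod.ext (max_eq_right hxx') (max_eq_left h12)
  rw [hinf, hsup] at key
  linarith [key]

/-- CDF form of the stochastic monotonicity: for rows of positive mass, `x ≤ x'` implies `F(y|x') ≤ F(y|x)`, where
`F(y|x) = μ(row x, ≤ y)/μ(row x)`. [this work] -/
theorem cdf_anti [LinearOrder α] [Fintype α] {μ : α × β → ℝ} (hμ : IsFKGMeasure μ) {x x' : α} (hxx' : x ≤ x') (hx : 0 < ∑ y₂, μ (x, y₂))
    (hx' : 0 < ∑ y₂, μ (x', y₂)) (y : β) :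
    (∑ y₁ ∈ univ.filter (fun y₁ => y₁ ≤ y), μ (x', y₁)) / (∑ y₂, μ (x', y₂)) ≤
      (∑ y₁ ∈ univ.filter (fun y₁ => y₁ ≤ y), μ (x, y₁)) / (∑ y₂, μ (x, y₂)) := by
  have hsplit : ∀ z : α, ∑ y₁ ∈ univ.filter (fun y₁ => y₁ ≤ y), μ (z, y₁) =
      (∑ y₂, μ (z, y₂)) - ∑ y₁ ∈ univ.filter (fun y₁ => y < y₁), μ (z, y₁) := by
    intro z
    rw [← Finset.sum_filter_add_sum_filter_not univ (fun y₁ => y < y₁) (fun y₁ => μ (z, y₁))]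
    have : univ.filter (fun y₁ => ¬ y < y₁) = univ.filter (fun y₁ => y₁ ≤ y) := by
      ext y₁; simp [not_lt]
    rw [this]
    ring
  rw [hsplit, hsplit, div_le_div_iff₀ hx' hx]
  have h := tail_mul_row_le hμ hxx' y
  nlinarith [h]


/-! ### The monotone quantile coupling of an FKG measure on a product of two chains -/

/-- The mass of the row `x`. [this work] -/
def rowMass (μ : α × β → ℝ) (x : α) : ℝ := ∑ y, μ (x, y)

/-- The conditional distribution function of the second coordinate given the row: `F(y|x) = μ(row x, ≤ y)/μ(row x)`
(junk value `0` for a row of mass `0`, by `x/0 = 0`). [this work] -/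
def cdf (μ : α × β → ℝ) (x : α) (y : β) : ℝ := (∑ y₁ ∈ univ.filter (fun y₁ => y₁ ≤ y), μ (x, y₁)) / rowMass μ x

/-- The strict version `F(<y|x) = μ(row x, < y)/μ(row x)`. [this work] -/
def cdfLt (μ : α × β → ℝ) (x : α) (y : β) : ℝ := (∑ y₁ ∈ univ.filter (fun y₁ => y₁ < y), μ (x, y₁)) / rowMass μ x

/-- The level-`(k+1)/N` quantile of the row `x`: the least `y` with `F(y|x) ≥ (k+1)/N` (junk value `univ.max'` if there is none,
which does not happen for `k < N` and a row of positive mass). [this work] -/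
def quantile [Nonempty β] (μ : α × β → ℝ) (N : ℕ) (x : α) (k : ℕ) : β :=
  if h : (univ.filter fun y => ((k : ℝ) + 1) / N ≤ cdf μ x y).Nonempty then
    (univ.filter fun y => ((k : ℝ) + 1) / N ≤ cdf μ x y).min' h
  else univ.max' univ_nonempty

variable {μ : α × β → ℝ}

omit [LinearOrder β] in
/-- Row masses are nonnegative. [this work] -/
theorem rowMass_nonneg (hμ0 : ∀ p, 0 ≤ μ p) (x : α) : 0 ≤ rowMass μ x :=
  Finset.sum_nonneg fun y _ => hμ0 (x, y)

omit [LinearOrder β] in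
/-- A point mass is at most its row mass. [this work] -/
theorem le_rowMass (hμ0 : ∀ p, 0 ≤ μ p) (x : α) (y : β) : μ (x, y) ≤ rowMass μ x := by
  unfold rowMass
  exact Finset.single_le_sum (f := fun y₁ => μ (x, y₁)) (fun y₁ _ => hμ0 (x, y₁)) (mem_univ y)

/-- `F(·|x)` is nondecreasing. [this work] -/
theorem cdf_mono (hμ0 : ∀ p, 0 ≤ μ p) (x : α) : Monotone (cdf μ x) := by
  intro y y' hyy'
  unfold cdf
  refine div_le_div_of_nonneg_right ?_ (rowMass_nonneg hμ0 x)
  refine Finset.sum_le_sum_of_subset_of_nonneg (fun y₁ hy₁ => ?_) fun y₁ _ _ => hμ0 (x, y₁)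
  rw [Finset.mem_filter] at hy₁ ⊢
  exact ⟨hy₁.1, hy₁.2.trans hyy'⟩

/-- `F(max|x) = 1` for a row of positive mass. [this work] -/
theorem cdf_max' [Nonempty β] (x : α) (hx : 0 < rowMass μ x) : cdf μ x (univ.max' univ_nonempty) = 1 := by
  unfold cdf
  have : univ.filter (fun y₁ : β => y₁ ≤ univ.max' univ_nonempty) = univ := by
    ext y₁
    simp only [Finset.mem_filter, Finset.mem_univ, true_and, iff_true]
    exact Finset.le_max' _ _ (mem_univ y₁)
  rw [this]
  exact div_self hx.ne'

/-- `0 ≤ F(y|x) ≤ 1`. [this work] -/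
theorem cdf_nonneg (hμ0 : ∀ p, 0 ≤ μ p) (x : α) (y : β) : 0 ≤ cdf μ x y :=
  div_nonneg (Finset.sum_nonneg fun y₁ _ => hμ0 (x, y₁)) (rowMass_nonneg hμ0 x)

/-- `F(y|x) ≤ 1`. [this work] -/
theorem cdf_le_one (hμ0 : ∀ p, 0 ≤ μ p) (x : α) (y : β) : cdf μ x y ≤ 1 := by
  unfold cdf
  refine div_le_one_of_le₀ ?_ (rowMass_nonneg hμ0 x)
  exact Finset.sum_le_sum_of_subset_of_nonneg (Finset.filter_subset _ _) fun y₁ _ _ => hμ0 (x, y₁)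

/-- `0 ≤ F(<y|x)`. [this work] -/
theorem cdfLt_nonneg (hμ0 : ∀ p, 0 ≤ μ p) (x : α) (y : β) : 0 ≤ cdfLt μ x y :=
  div_nonneg (Finset.sum_nonneg fun y₁ _ => hμ0 (x, y₁)) (rowMass_nonneg hμ0 x)

/-- `F(y|x) − F(<y|x) = μ(x,y)/μ(row x)`. [this work] -/
theorem cdf_sub_cdfLt (x : α) (y : β) : cdf μ x y - cdfLt μ x y = μ (x, y) / rowMass μ x := by
  unfold cdf cdfLt
  rw [← sub_div]
  congr 1
  have hsplit : univ.filter (fun y₁ : β => y₁ ≤ y) = insert y (univ.filter fun y₁ : β => y₁ < y) := by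
    ext y₁
    simp only [Finset.mem_filter, Finset.mem_univ, true_and, Finset.mem_insert, le_iff_lt_or_eq]
    tauto
  rw [hsplit, Finset.sum_insert (by simp)]
  ring

/-- For `k < N` and a row of positive mass the quantile set is nonempty (it contains the maximum). [this work] -/
theorem quantile_set_nonempty [Nonempty β] {N : ℕ} {k : ℕ} (hk : k < N) (x : α)
    (hx : 0 < rowMass μ x) : (univ.filter fun y => ((k : ℝ) + 1) / N ≤ cdf μ x y).Nonempty := by
  refine ⟨univ.max' univ_nonempty, ?_⟩
  rw [Finset.mem_filter, cdf_max' x hx]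
  refine ⟨mem_univ _, ?_⟩
  have hN : (0 : ℝ) < N := by exact_mod_cast (Nat.zero_lt_of_lt hk)
  rw [div_le_one hN]
  exact_mod_cast Nat.succ_le_of_lt hk

/-- **The quantile characterisation**: for `k < N` and a positive row, `quantile ≤ y ↔ (k+1)/N ≤ F(y|x)`. [this work] -/
theorem quantile_le_iff [Nonempty β] (hμ0 : ∀ p, 0 ≤ μ p) {N : ℕ} {k : ℕ} (hk : k < N) {x : α}
    (hx : 0 < rowMass μ x) (y : β) : quantile μ N x k ≤ y ↔ ((k : ℝ) + 1) / N ≤ cdf μ x y := by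
  have hne := quantile_set_nonempty hk x hx
  unfold quantile
  rw [dif_pos hne]
  constructor
  · intro h
    have hmem := Finset.min'_mem _ hne
    rw [Finset.mem_filter] at hmem
    exact hmem.2.trans (cdf_mono hμ0 x h)
  · intro h
    exact Finset.min'_le _ _ (by rw [Finset.mem_filter]; exact ⟨mem_univ _, h⟩)

/-- The strict companion: `quantile < y ↔ (k+1)/N ≤ F(<y|x)`. [this work] -/
theorem quantile_lt_iff [Nonempty β] (hμ0 : ∀ p, 0 ≤ μ p) {N : ℕ} {k : ℕ} (hk : k < N) {x : α}
    (hx : 0 < rowMass μ x) (y : β) : quantile μ N x k < y ↔ ((k : ℝ) + 1) / N ≤ cdfLt μ x y := by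
  constructor
  · intro h
    have hq := (quantile_le_iff hμ0 hk hx (quantile μ N x k)).1 le_rfl
    refine hq.trans ?_
    unfold cdf cdfLt
    refine div_le_div_of_nonneg_right ?_ (rowMass_nonneg hμ0 x)
    refine Finset.sum_le_sum_of_subset_of_nonneg (fun y₁ hy₁ => ?_) fun y₁ _ _ => hμ0 (x, y₁)
    rw [Finset.mem_filter] at hy₁ ⊢
    exact ⟨hy₁.1, lt_of_le_of_lt hy₁.2 h⟩
  · intro h
    by_cases hS : (univ.filter fun y₁ : β => y₁ < y).Nonempty
    · set y₀ := (univ.filter fun y₁ : β => y₁ < y).max' hS with hy₀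
      have hy₀y : y₀ < y := by
        have := Finset.max'_mem _ hS
        rw [Finset.mem_filter] at this
        exact this.2
      have hsets : univ.filter (fun y₁ : β => y₁ < y) = univ.filter (fun y₁ : β => y₁ ≤ y₀) := by
        ext y₁
        simp only [Finset.mem_filter, Finset.mem_univ, true_and]
        constructor
        · intro hy₁
          exact Finset.le_max' _ _ (by rw [Finset.mem_filter]; exact ⟨mem_univ _, hy₁⟩)
        · intro hy₁
          exact lt_of_le_of_lt hy₁ hy₀y
      have hcdf : cdfLt μ x y = cdf μ x y₀ := by
        unfold cdf cdfLt
        rw [hsets]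
      rw [hcdf] at h
      exact lt_of_le_of_lt ((quantile_le_iff hμ0 hk hx y₀).2 h) hy₀y
    · exfalso
      have hzero : cdfLt μ x y = 0 := by
        unfold cdfLt
        rw [Finset.not_nonempty_iff_eq_empty.1 hS, Finset.sum_empty, zero_div]
      rw [hzero] at h
      have hN : (0 : ℝ) < N := by exact_mod_cast (Nat.zero_lt_of_lt hk)
      have : (0 : ℝ) < ((k : ℝ) + 1) / N := by positivity
      linarith

/-- **The quantile map is monotone in the row** (stochastic monotonicity of the conditionals, `cdf_anti`). [this work] -/
theorem quantile_mono_row [LinearOrder α] [Fintype α] [Nonempty β] (hμ : IsFKGMeasure μ) {N : ℕ} {k : ℕ} (hk : k < N) {x x' : α} (hxx' : x ≤ x')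
    (hx : 0 < rowMass μ x) (hx' : 0 < rowMass μ x') : quantile μ N x k ≤ quantile μ N x' k := by
  rw [quantile_le_iff hμ.nonneg hk hx]
  have h1 := (quantile_le_iff hμ.nonneg hk hx' (quantile μ N x' k)).1 le_rfl
  exact h1.trans (cdf_anti hμ hxx' hx hx' _)

/-- The quantile map is monotone in the level. [this work] -/
theorem quantile_mono_level [Nonempty β] (hμ0 : ∀ p, 0 ≤ μ p) {N : ℕ} {k k' : ℕ} (hkk' : k ≤ k') (hk' : k' < N) {x : α}
    (hx : 0 < rowMass μ x) : quantile μ N x k ≤ quantile μ N x k' := by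
  rw [quantile_le_iff hμ0 (lt_of_le_of_lt hkk' hk') hx]
  have h1 := (quantile_le_iff hμ0 hk' hx (quantile μ N x k')).1 le_rfl
  refine le_trans ?_ h1
  have hN : (0 : ℝ) < N := by exact_mod_cast (Nat.zero_lt_of_lt hk')
  exact div_le_div_of_nonneg_right (by exact_mod_cast Nat.add_le_add_right hkk' 1) hN.le

/-- **Counting the levels below a point**: `#{k < N : quantile_k ≤ y} = ⌊N·F(y|x)⌋`. [this work] -/
theorem card_quantile_le [Nonempty β] (hμ0 : ∀ p, 0 ≤ μ p) {N : ℕ} (hN : 0 < N) {x : α} (hx : 0 < rowMass μ x) (y : β) :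
    (univ.filter fun k : Fin N => quantile μ N x k ≤ y).card = ⌊(N : ℝ) * cdf μ x y⌋₊ := by
  have hNr : (0 : ℝ) < N := by exact_mod_cast hN
  have hc0 := cdf_nonneg hμ0 x y
  have hc1 := cdf_le_one hμ0 x y
  have hset : univ.filter (fun k : Fin N => quantile μ N x k ≤ y) =
      univ.filter (fun k : Fin N => (k : ℕ) < ⌊(N : ℝ) * cdf μ x y⌋₊) := by
    ext k
    simp only [Finset.mem_filter, Finset.mem_univ, true_and]
    rw [quantile_le_iff hμ0 k.isLt hx, div_le_iff₀ hNr, ← Nat.succ_le_iff, Nat.succ_eq_add_one,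
      Nat.le_floor_iff (by positivity)]
    push_cast
    rw [mul_comm]
  have hle : ⌊(N : ℝ) * cdf μ x y⌋₊ ≤ N := by
    refine Nat.floor_le_of_le ?_
    calc (N : ℝ) * cdf μ x y ≤ (N : ℝ) * 1 := by gcongr
      _ = N := mul_one _
  rw [hset, Fin.card_filter_val_lt, min_eq_right hle]

/-- The strict companion: `#{k < N : quantile_k < y} = ⌊N·F(<y|x)⌋`. [this work] -/
theorem card_quantile_lt [Nonempty β] (hμ0 : ∀ p, 0 ≤ μ p) {N : ℕ} (hN : 0 < N) {x : α} (hx : 0 < rowMass μ x) (y : β) :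
    (univ.filter fun k : Fin N => quantile μ N x k < y).card = ⌊(N : ℝ) * cdfLt μ x y⌋₊ := by
  have hNr : (0 : ℝ) < N := by exact_mod_cast hN
  have hc0 := cdfLt_nonneg hμ0 x y
  have hc1 : cdfLt μ x y ≤ 1 := by
    have := cdf_sub_cdfLt (μ := μ) x y
    have h2 := cdf_le_one hμ0 x y
    have h3 : 0 ≤ μ (x, y) / rowMass μ x := div_nonneg (hμ0 _) (rowMass_nonneg hμ0 x)
    linarith
  have hset : univ.filter (fun k : Fin N => quantile μ N x k < y) =
      univ.filter (fun k : Fin N => (k : ℕ) < ⌊(N : ℝ) * cdfLt μ x y⌋₊) := by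
    ext k
    simp only [Finset.mem_filter, Finset.mem_univ, true_and]
    rw [quantile_lt_iff hμ0 k.isLt hx, div_le_iff₀ hNr, ← Nat.succ_le_iff, Nat.succ_eq_add_one,
      Nat.le_floor_iff (by positivity)]
    push_cast
    rw [mul_comm]
  have hle : ⌊(N : ℝ) * cdfLt μ x y⌋₊ ≤ N := by
    refine Nat.floor_le_of_le ?_
    calc (N : ℝ) * cdfLt μ x y ≤ (N : ℝ) * 1 := by gcongr
      _ = N := mul_one _
  rw [hset, Fin.card_filter_val_lt, min_eq_right hle]


/-! ### The approximating push-forward measures and the limit -/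

/-- The rows of positive mass (the latent first coordinate). [this work] -/
abbrev PosRow (μ : α × β → ℝ) : Type _ := {x : α // 0 < rowMass μ x}

/-- The latent product weight on `PosRow μ × Fin N`: `(row mass) ⊗ (uniform)`. [this work] -/
def latentWeight (μ : α × β → ℝ) (N : ℕ) (p : PosRow μ × Fin N) : ℝ := rowMass μ p.1.1 * (1 / (N : ℝ))

/-- The monotone coupling map `(x, k) ↦ (x, quantile_k(x))`. [this work] -/
def latentMap [Nonempty β] (μ : α × β → ℝ) (N : ℕ) (p : PosRow μ × Fin N) : α × β := (p.1.1, quantile μ N p.1.1 p.2)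

/-- The `N`-th approximating measure: the push-forward of the latent product weight along the coupling map. [this work] -/
def approxMeasure [Fintype α] [Nonempty β] (μ : α × β → ℝ) (N : ℕ) : α × β → ℝ :=
  pushWeight (latentWeight μ N) (latentMap μ N)

end FKG

end SahiTwoChain

end Summit.CriticalPhenomena.PercolationContinuityZ3.Theorems
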